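import Summits.AnomalousDissipation.AnomalousDissipation.Theorems.MomentParityQuarticTightnessStubHorizonConverse
import Summits.AnomalousDissipation.AnomalousDissipation.Theorems.MomentParityQuarticTightnessHorizonKrylovBogoliubov
import Summits.AnomalousDissipation.AnomalousDissipation.Theorems.MomentParityQuarticTightnessStubInvariantOfLadder

/-!
# Route MomentParity / QuarticLadder · crux `QuarticTightness` (stmt-AnomalousDissipation-14331), line `horizon-shooting`:
# the crux IS the gate-relative Galerkin-ensemble floor, and IS gate-relative horizon loudness (kernel-checked both ways)

Support file of the line lead (continuation c13). With the κ-free polynomial moment closure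
`MomentParityQuarticTightness.stub_invariantOfLadder` (p141515) the CONCLUSION of the crux (`LadderConcl`: loud bounded
`d`-stationary level-`N` laws for every order `d`, the measure depending on `d`) is EQUIVALENT, with the same budgets and
radii, to a loud bounded Galerkin-INVARIANT family (`InvariantFamily`, the body of the rank-4 sibling crux
`GalerkinInvariantLoud` at that force): `ladderConcl_iff_invariantFamily`. Consequently

* `stub_quarticTightnessIffGateInvariantFamily` — `QuarticTightness ↔` (for every admissible force, null viscosity sequence
  and budgets, the GATE HYPOTHESIS yields a loud bounded Galerkin-invariant family for some budgets): the refuter's F2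
  "κ-free MomentClosure glue gap" is closed, and the crux is certified to be the gate-relative Galerkin-ensemble floor;
* `stub_quarticTightnessIffGateHorizonLoud` — `QuarticTightness ↔` the line's open stub S6\* `stub_gateHorizonLoud`
  (gate hypothesis ⇒ `j`-uniform HORIZON LOUDNESS: at every `j`, `N`-frequently, every horizon `T > 0` has one mean-zero
  Galerkin datum in the absorbing ball `‖a‖₂ ≤ ‖f‖₂/(4π²ν_j)` with window work `≥ ε'T` and window energy `≤ E'T`):
  `←` by the landed moving-base Krylov–Bogoliubov glue `stub_horizonKrylovBogoliubov` (p91780), `→` by the closure and the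
  landed converse `stub_horizonConverse` (p93240) with the `j`-uniform budgets `((4‖f‖₂E'/ε')² + 1, ε'/2)`.

So the one open stub of the line no longer dominates the crux (as v2's universal `stub_universalHorizonLoud` = UEF did):
it is the crux in finite-horizon, sup-over-data currency. Both statements are registered calibration stubs of the
skeleton `Cruxes/QuarticTightness/Lines/Ideate3Sketch.lean` v3. Sources: FMRT 2001 Ch. IV App. B (Galerkin invariant
measures, Liouville equation); Tobasco–Goluskin–Doering 2018 §5. No new definitions; nothing here proves a Theses decl.
-/

noncomputable section

-- `Summit.<Summit>.<Problem>` is the tree's mandated summit-side namespace (CONVENTIONS §2); for this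
-- single-conjunct summit the two coincide, so the duplicate is deliberate.
set_option linter.dupNamespace false

namespace Summit.AnomalousDissipation.AnomalousDissipation.Theorems.MomentParityQuarticTightness

open MeasureTheory Filter Topology Set Function
open scoped ENNReal InnerProductSpace RealInnerProductSpace
open Literature.Analysis.FunctionSpaces Literature.Analysis.FunctionSpaces.Torus
open Literature.Analysis.FluidPDE Literature.Analysis.FluidPDE.Torus
open Summit.AnomalousDissipation.AnomalousDissipation.Theses.MomentParity
open Summit.AnomalousDissipation.AnomalousDissipation.Theorems
open Summit.AnomalousDissipation.AnomalousDissipation.Theorems.QuarticGate.Negative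
open Summit.AnomalousDissipation.AnomalousDissipation.Theorems.QuarticTightness.Negative

-- `T3 = T³`, `R3 = ℝ³`, `H3 = H`, `L2T3 = L²(T³; ℝ³)` (sibling crux's abbreviations).
open Summit.AnomalousDissipation.AnomalousDissipation.Theorems.CubicParityLoud.Negative (T3 R3 H3 L2T3)

/-! ## The conclusion of the crux is a Galerkin-invariant loud family -/

/-- **`LadderConcl ⟺ InvariantFamily`** (same force, sequence, budgets; same radii and levels): `←` is Anatomy's
`ladderConcl_of_invariantFamily` (an invariant witness is a ladder witness at every order); `→` is the κ-free polynomial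
moment closure `stub_invariantOfLadder`, level by level. [folklore] -/
theorem ladderConcl_iff_invariantFamily {f : T3 → R3} (hfs : Torus.IsSmooth f) {ν : ℕ → ℝ} {E ε : ℝ} :
    LadderConcl f ν E ε ↔ InvariantFamily f ν E ε := by
  refine ⟨fun h j => ?_, ladderConcl_of_invariantFamily⟩
  obtain ⟨R, hR⟩ := h j
  exact ⟨R, hR.mono fun N hN => stub_invariantOfLadder hfs hN⟩

/-- **The crux IS the gate-relative Galerkin-ensemble floor.** `QuarticTightness` holds iff for every admissible force,
every positive null viscosity sequence and all budgets `E`, `ε > 0`, the gate hypothesis (loud 4-stationary level-`N` laws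
with finite fourth moments, `N`-frequently at every `j`) yields, for some budgets `E'`, `ε' > 0`, a loud bounded
Galerkin-INVARIANT family along the same sequence (registered calibration stub of the line's skeleton v3). [folklore] -/
theorem stub_quarticTightnessIffGateInvariantFamily :
    QuarticTightness ↔ ∀ f : T3 → R3, Torus.IsSmooth f → Torus.IsDivFree f → Torus.HasZeroMean f →
      ∀ (ν : ℕ → ℝ) (E ε : ℝ), (∀ j, 0 < ν j) → Tendsto ν atTop (𝓝 0) → 0 < ε →
      GateHyp f ν E ε → ∃ E' ε' : ℝ, 0 < ε' ∧ InvariantFamily f ν E' ε' := by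
  rw [quarticTightness_iff]
  refine ⟨fun h f hfs hfd hfz ν E ε hν hν0 hε hH => ?_, fun h f hfs hfd hfz ν E ε hν hν0 hε hH => ?_⟩
  · obtain ⟨E', ε', hε', hL⟩ := h f hfs hfd hfz ν E ε hν hν0 hε hH
    exact ⟨E', ε', hε', (ladderConcl_iff_invariantFamily hfs).1 hL⟩
  · obtain ⟨E', ε', hε', hI⟩ := h f hfs hfd hfz ν E ε hν hν0 hε hH
    exact ⟨E', ε', hε', ladderConcl_of_invariantFamily hI⟩

/-! ## The crux is gate-relative horizon loudness (the line's open stub S6\*) -/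

/-- **`QuarticTightness ⟺ S6\*` (gate-relative horizon loudness).** `←`: horizon loudness at `(f, ν_j, N)` with
`j`-uniform budgets gives, through the moving-base Krylov–Bogoliubov glue `stub_horizonKrylovBogoliubov`, an invariant
loud witness supported in the absorbing ball, hence the ladder at every order (`ladderConcl_of_invariantFamily`). `→`:
the ladder conclusion is an invariant family in the same balls (`ladderConcl_iff_invariantFamily`), and an invariant
witness with budgets `(E', ε')` shoots, at EVERY horizon, a loud window from the absorbing ball with the `j`-UNIFORM
budgets `M = (4‖f‖₂E'/ε')² + 1`, `ε'/2` (`stub_horizonConverse`). Registered calibration stub of the skeleton v3: the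
line's single open stub is exactly crux-sized, neither more nor less. [folklore] -/
theorem stub_quarticTightnessIffGateHorizonLoud :
    QuarticTightness ↔ ∀ f : T3 → R3, Torus.IsSmooth f → Torus.IsDivFree f → Torus.HasZeroMean f →
      ∀ (ν : ℕ → ℝ) (E ε : ℝ), (∀ j, 0 < ν j) → Tendsto ν atTop (𝓝 0) → 0 < ε → GateHyp f ν E ε →
      ∃ E' ε' : ℝ, 0 < ε' ∧ ∀ j : ℕ, ∃ᶠ N in atTop, ∀ T : ℝ, 0 < T →
        ∃ a : T3 → R3, IsGalerkinMode N a ∧ Torus.HasZeroMean a ∧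
          ∫ x, ‖a x‖ ^ 2 ≤ (Real.sqrt (∫ x, ‖f x‖ ^ 2) / (4 * Real.pi ^ 2 * ν j)) ^ 2 ∧
          ε' * T ≤ ∫ t in (0 : ℝ)..T, ∫ x, ⟪f x, Torus.galerkinFlow (ν j) f N t a x⟫_ℝ ∧
          ∫ t in (0 : ℝ)..T, ∫ x, ‖Torus.galerkinFlow (ν j) f N t a x‖ ^ 2 ≤ E' * T := by
  rw [stub_quarticTightnessIffGateInvariantFamily]
  refine ⟨fun h f hfs hfd hfz ν E ε hν hν0 hε hH => ?_, fun h f hfs hfd hfz ν E ε hν hν0 hε hH => ?_⟩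
  · obtain ⟨E', ε', hε', hI⟩ := h f hfs hfd hfz ν E ε hν hν0 hε hH
    -- the `j`-uniform window-energy budget of the converse
    set F : ℝ := Real.sqrt (∫ x, ‖f x‖ ^ 2) with hF
    set M : ℝ := (4 * F * E' / ε') ^ 2 + 1 with hM
    have hM0 : 0 < M := by positivity
    have hFE : F * E' ≤ ε' / 4 * Real.sqrt M := by
      have h1 : |4 * F * E' / ε'| ≤ Real.sqrt M := by
        rw [← Real.sqrt_sq_eq_abs]
        exact Real.sqrt_le_sqrt (by rw [hM]; linarith)
      have h2 : 4 * F * E' / ε' ≤ Real.sqrt M := (le_abs_self _).trans h1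
      rw [div_le_iff₀ hε'] at h2
      linarith
    refine ⟨M, ε' / 2, by positivity, fun j => ?_⟩
    obtain ⟨R, hR⟩ := hI j
    refine hR.mono ?_
    rintro N ⟨μ, hμ⟩ T hT
    exact stub_horizonConverse hfs hfz (hν j) hε' hμ hM0 hFE hT
  · obtain ⟨E', ε', hε', hj⟩ := h f hfs hfd hfz ν E ε hν hν0 hε hH
    exact ⟨E', ε', hε', fun j => ⟨_, (hj j).mono fun N hN => stub_horizonKrylovBogoliubov hfs hfz (hν j) hN⟩⟩

end Summit.AnomalousDissipation.AnomalousDissipation.Theorems.MomentParityQuarticTightness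

end
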